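import Summits.CriticalPhenomena.PercolationContinuityZ3.Theorems.PercNearOneGluingNoHeavyLowerTailAntipodalStrongHarris
import Mathlib
import HarnessLib
import HarnessLib.Audit.Tags

/-!
# `NoHeavyLowerTail` (crux stmt-CriticalPhenomena-4575), master-family line P1 (gen 15):
# the PIVOT-RESTRICTED tripartition functional `Ψ_U`, a one-parameter family of comb inequalities
# interpolating the antipodal strong Harris–Kleitman inequality (`U = ∅`) and the cubic comb law CP3⁺ at
# pure patterns (`U = S`)

Support file (seat `prim-masterthm-p1`, gen 15; `--supports stmt-CriticalPhenomena-4575`).  Definitions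
(`polar`, `rainbow`, `lam`, `pivotSum`, the typed conjectures `PivotFamilyNonneg`, `PurePatternCP3Plus`), the
proved end `U = ∅` of the family, the idle-coordinate identity, and the kernel link
`PivotFamilyNonneg → PurePatternCP3Plus`; no `sorry`, standard axioms.  Memo
`run/shared/lean/prim/prim-masterthm/FROM-prim-masterthm-p1-g15-PIVOT-FAMILY.md`.

SETTING (tree `AntipodalStrongHarris`): a `k`-sunflower of up-sets of `2^S` is a labeling
`f : Finset α → Lab k` monotone for `B < Cᵢ < A` (`bot` = outside, `petal i`, `top` = core).  An ORDERED
TRIPARTITION of `S` is a pair `(W, X)` with `W ⊆ S`, `X ⊆ S ∖ W` (third part `S ∖ W ∖ X`); `W` is called the PIVOT.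

THE FUNCTIONAL.  With the pair weight `κ` of the tree (`+1` on `{A,B}` pairs, `−1` on two different petals) put
`λ(a; b, c) := 3·[a ∈ {A,B}]·κ(b,c) − [a, b, c three pairwise different petals]` and, for `U ⊆ S`,
`Ψ_U(f) := Σ_{W ⊆ U} Σ_{X ⊆ S∖W} λ(f W; f X, f(S∖W∖X))` (`pivotSum S U f`): the pivot is restricted to subsets of `U`.
* `U = ∅`: `Ψ_∅(f) = 3·Σ_X κ(f X, f(S∖X))` when `f ∅` is polar (`pivotSum_empty_nonneg`, from the tree's
  `antipodalSum_self_nonneg` — Gladkov's Theorem 2.1 profile by profile).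
* `U = S`: `Ψ_S(f) = Σ_{ordered tripartitions} λ = 2·#AAB + 2·#ABB − #ACD − #BCD − #CDE` (label-multiset counts of ordered
  tripartitions; the 6-fold symmetrisation of the pivot-first kernel `λ` is the multiset kernel), i.e. the fibre form of the
  seat's comb conjecture CP3⁺ (gen 13, measure shadow `(κ+o)(κo−e₂) ≥ e₃`, tree `SahiDeepCore.StrongCubicPlusNonneg`) at a PURE
  pattern (a fibre all of whose mixed coordinates carry exactly one `1` among the three configurations; mixed coordinates with
  two `1`s give "twisted" systems, for which the family below FAILS while CP3⁺ itself survives — memo §3).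
* general `U`: in the random-tripartition model, `Ψ_U ≥ 0` for all `U` says `E_q[λ(X₁; X₂, X₃)] ≥ 0` for every vector of
  pivot rates `q_e ∈ [0, 1/3]` (multi-affine in `q`; `q ≡ 0` Gladkov, `q ≡ 1/3` CP3⁺); `U = S ∖ {e}` is the statement
  "the polar pivots AVOIDING `e` already pay for two thirds of all rainbows", equivalently `Ψ(g; h, g) ≥ 0` for the two
  sections `g ≤ h` of a system one dimension up — an ORDERED two-labeling law with an asymmetric kernel (pivot read through
  the LOWER section) whose positional symmetrisation is CP3⁺; applied to an idle coordinate it IS CP3⁺ (`pivotSum_idle`).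

CONJECTURE (`PivotFamilyNonneg`, typed; census gen 15: all 74 229 labelings of `2^4` × all `U` exhaustive, `2^5`/`2^6`/`2^7`
3.2·10⁶ / 2·10⁶ / 1.2·10⁶ random + annealing-adversarial systems × all `U`, compositions of every 3-coordinate system with
AND/OR blocks, `k = 4, 5` petals 2.4·10⁵ systems — 0 failures, minimum exactly `0` (dressings of the standard example);
the companion "pivots CONTAINING `e`" half and every termwise/sectional split are genuinely signed — memo §2).
HONEST FRAMING: definitions + the Gladkov end + bookkeeping identities; `Ψ_U ≥ 0` for `U ≠ ∅` and CP3⁺ remain OPEN. [this work]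
-/

namespace Summit.CriticalPhenomena.PercolationContinuityZ3.Theorems

namespace SahiPivotFamily

open Finset AntipodalStrongHarris AntipodalStrongHarris.Lab

variable {k : ℕ}

/-! ### 1. The pivot kernel -/

/-- Indicator (as an integer) of the two POLAR labels `A` (core) and `B` (outside). [this work] -/
def polar : Lab k → ℤ
  | top => 1
  | bot => 1
  | petal _ => 0

/-- Indicator (as an integer) of a RAINBOW: three pairwise different petals. [this work] -/
def rainbow : Lab k → Lab k → Lab k → ℤ
  | petal i, petal j, petal l => if i ≠ j ∧ j ≠ l ∧ i ≠ l then 1 else 0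
  | _, _, _ => 0

/-- **The pivot kernel** `λ(a; b, c) = 3·[a polar]·κ(b,c) − [a,b,c rainbow]`: a polar pivot contributes three times the
Gladkov pair weight of the other two parts, a petal pivot pays `1` for every rainbow it completes. Its symmetrisation over
the six orderings is the label-multiset kernel `(AAB:2, ABB:2, ACD:−1, BCD:−1, CDE:−1)` of CP3⁺. [this work] -/
def lam (a b c : Lab k) : ℤ := 3 * polar a * kappa b c - rainbow a b c

/-- `polar` takes the value `0` (petals) or `1` (core/outside). [this work] -/
theorem polar_eq_zero_or_one (a : Lab k) : polar a = 0 ∨ polar a = 1 := by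
  cases a <;> simp [polar]

/-- A rainbow needs its second entry to be a petal DIFFERENT from the first: if `a ≤ b` in the label order
(`a = B`, or `b = A`, or `a = b`) there is no rainbow `(a, b, c)`. [this work] -/
theorem rainbow_eq_zero_of_le {a b : Lab k} (hab : a ≤ b) (c : Lab k) : rainbow a b c = 0 := by
  rw [le_def] at hab
  rcases a with _ | i | _ <;> rcases b with _ | j | _ <;> rcases c with _ | l | _ <;> simp_all [rainbow]

/-- With a polar pivot the kernel is `3κ` (a polar label starts no rainbow). [this work] -/
theorem lam_of_polar {a : Lab k} (ha : polar a = 1) (b c : Lab k) : lam a b c = 3 * kappa b c := by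
  rcases a with _ | i | _
  · simp [lam, ha, rainbow]
  · simp [polar] at ha
  · simp [lam, ha, rainbow]

/-- With a petal pivot the kernel is minus the rainbow indicator. [this work] -/
theorem lam_of_not_polar {a : Lab k} (ha : polar a = 0) (b c : Lab k) : lam a b c = -rainbow a b c := by
  simp [lam, ha]

/-! ### 2. The pivot-restricted tripartition functional -/

variable {α : Type*} [DecidableEq α]

/-- **The pivot-restricted tripartition functional** `Ψ_U(f) = Σ_{W ⊆ U} Σ_{X ⊆ S ∖ W} λ(f W; f X, f(S ∖ W ∖ X))`:
the CP3⁺ tripartition sum of the cube `2^S` with the pivot part `W` restricted to subsets of `U`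
(meaningful for `U ⊆ S`). [this work] -/
def pivotSum (S U : Finset α) (f : Finset α → Lab k) : ℤ :=
  ∑ W ∈ U.powerset, ∑ X ∈ (S \ W).powerset, lam (f W) (f X) (f ((S \ W) \ X))

/-- `U = ∅`: only the empty pivot, `Ψ_∅(f) = Σ_{X ⊆ S} λ(f ∅; f X, f(S∖X))`. [this work] -/
theorem pivotSum_empty (S : Finset α) (f : Finset α → Lab k) :
    pivotSum S ∅ f = ∑ X ∈ S.powerset, lam (f ∅) (f X) (f (S \ X)) := by
  simp [pivotSum]

/-- With a polar label at `∅` the `U = ∅` member is three times the antipodal pairing sum of the tree. [this work] -/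
theorem pivotSum_empty_of_polar (S : Finset α) (f : Finset α → Lab k) (h0 : polar (f ∅) = 1) :
    pivotSum S ∅ f = 3 * antipodalSum S f f := by
  rw [pivotSum_empty, antipodalSum, mul_sum]
  exact sum_congr rfl fun X _ => lam_of_polar h0 _ _

/-- With a petal label at `∅` (a monotone labeling then takes only the values `Cᵢ` and `A`) the `U = ∅` member
vanishes. [this work] -/
theorem pivotSum_empty_of_not_polar (S : Finset α) (f : Finset α → Lab k)
    (hf : ∀ ⦃X Y : Finset α⦄, X ⊆ Y → f X ≤ f Y) (h0 : polar (f ∅) = 0) : pivotSum S ∅ f = 0 := by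
  rw [pivotSum_empty]
  refine sum_eq_zero fun X _ => ?_
  rw [lam_of_not_polar h0, rainbow_eq_zero_of_le (hf (empty_subset X)), neg_zero]

/-- **The Gladkov end of the family (`U = ∅`, PROVED).**  For every sunflower labeling `f` of `2^S`,
`0 ≤ Ψ_∅(f)`: if `f ∅` is polar this is `3·Σ_X κ(f X, f(S∖X)) ≥ 0`, the antipodal strong Harris–Kleitman inequality
of the tree (Gladkov's Theorem 2.1 profile by profile); if `f ∅` is a petal every term vanishes.
[this work; uses the tree's `antipodalSum_self_nonneg`] -/
theorem pivotSum_empty_nonneg (S : Finset α) (f : Finset α → Lab k)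
    (hf : ∀ ⦃X Y : Finset α⦄, X ⊆ Y → f X ≤ f Y) : 0 ≤ pivotSum S ∅ f := by
  rcases polar_eq_zero_or_one (f ∅) with h0 | h0
  · rw [pivotSum_empty_of_not_polar S f hf h0]
  · rw [pivotSum_empty_of_polar S f h0]
    exact mul_nonneg (by norm_num) (antipodalSum_self_nonneg S f hf)

/-! ### 3. Splitting off a coordinate outside the pivot set: the two-labeling ("sections") form, and the idle identity -/

/-- **Section form of the members with a pivot-free coordinate.**  For `e ∉ S` and any labeling `F` of `2^{S ∪ {e}}`,
the member `U = S` of the family on the ground set `S ∪ {e}` (pivots avoiding `e`) is the ordered-tripartition sum over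
`2^S` of `λ(g W; h X, g Y) + λ(g W; g X, h Y)` with the two SECTIONS `g = F`, `h = F(· ∪ {e})`: the pivot is read through
the lower section, exactly one of the two pair members through the upper one.  For a sunflower labeling (`g ≤ h`) this is the
asymmetric ordered two-labeling law "(**)" of the memo, whose positional symmetrisation is CP3⁺. [this work] -/
theorem pivotSum_insert_of_notMem (S : Finset α) {e : α} (he : e ∉ S) (F : Finset α → Lab k) :
    pivotSum (insert e S) S F = ∑ W ∈ S.powerset, ∑ X ∈ (S \ W).powerset,
      (lam (F W) (F X) (F (insert e ((S \ W) \ X))) + lam (F W) (F (insert e X)) (F ((S \ W) \ X))) := by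
  unfold pivotSum
  refine sum_congr rfl fun W hW => ?_
  have hWS : W ⊆ S := mem_powerset.mp hW
  have heW : e ∉ W := fun h => he (hWS h)
  have hsd : insert e S \ W = insert e (S \ W) := by
    ext x
    simp only [mem_sdiff, mem_insert]
    constructor
    · rintro ⟨h1 | h1, h2⟩
      · exact Or.inl h1
      · exact Or.inr ⟨h1, h2⟩
    · rintro (rfl | ⟨h1, h2⟩)
      · exact ⟨Or.inl rfl, heW⟩
      · exact ⟨Or.inr h1, h2⟩
  have heSW : e ∉ S \ W := fun h => he (mem_sdiff.mp h).1
  rw [hsd, sum_powerset_insert heSW, ← sum_add_distrib]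
  refine sum_congr rfl fun X hX => ?_
  have hXS : X ⊆ S \ W := mem_powerset.mp hX
  have heX : e ∉ X := fun h => heSW (hXS h)
  have e1 : insert e (S \ W) \ X = insert e ((S \ W) \ X) := by
    ext x
    simp only [mem_sdiff, mem_insert]
    constructor
    · rintro ⟨(rfl | hx), hxX⟩
      · exact Or.inl rfl
      · exact Or.inr ⟨hx, hxX⟩
    · rintro (rfl | ⟨hx, hxX⟩)
      · exact ⟨Or.inl rfl, heX⟩
      · exact ⟨Or.inr hx, hxX⟩
  have e2 : insert e (S \ W) \ insert e X = (S \ W) \ X := by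
    ext x
    simp only [mem_sdiff, mem_insert, not_or]
    constructor
    · rintro ⟨(rfl | hx), hxe, hxX⟩
      · exact (hxe rfl).elim
      · exact ⟨hx, hxX⟩
    · rintro ⟨hx, hxX⟩
      have hne : x ≠ e := fun h => heSW (h ▸ mem_sdiff.mpr hx)
      exact ⟨Or.inr hx, hne, hxX⟩
  rw [e1, e2]

/-- **Idle-coordinate identity.**  For `e ∉ S` and the labeling `f ∘ erase e` of `2^{S ∪ {e}}` (coordinate `e` idle),
the member `U = S` of the family on the ground set `S ∪ {e}` — pivots avoiding `e` — equals `2·Ψ_S(f)`, twice the full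
tripartition functional (CP3⁺ form) of `f` on `S`: every antipodal pair of a cube containing `e` is an antipodal pair of the
`e`-less cube counted twice.  Hence the conjecture below, applied to idle extensions, contains CP3⁺ at pure patterns; and the
member `U = S ∖ {e}` for a NON-idle `e` is a genuinely stronger, asymmetric statement. [this work] -/
theorem pivotSum_idle (S : Finset α) {e : α} (he : e ∉ S) (f : Finset α → Lab k) :
    pivotSum (insert e S) S (fun X => f (X.erase e)) = 2 * pivotSum S S f := by
  rw [pivotSum_insert_of_notMem S he, pivotSum, mul_sum]
  refine sum_congr rfl fun W hW => ?_
  have hWS : W ⊆ S := mem_powerset.mp hW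
  have heW : e ∉ W := fun h => he (hWS h)
  rw [mul_sum]
  refine sum_congr rfl fun X hX => ?_
  have hXS : X ⊆ S \ W := mem_powerset.mp hX
  have heSW : e ∉ S \ W := fun h => he (mem_sdiff.mp h).1
  have heX : e ∉ X := fun h => heSW (hXS h)
  have heY : e ∉ (S \ W) \ X := fun h => heSW (mem_sdiff.mp h).1
  simp only [erase_eq_of_notMem heW, erase_eq_of_notMem heX, erase_eq_of_notMem heY, erase_insert heX,
    erase_insert heY]
  ring

/-! ### 4. The typed conjectures and the kernel link -/

/-- **CONJECTURE (pivot family; typed).**  For every `k`, every finite ground set `S ⊆ ℕ`, every sunflower labeling `f`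
of its subsets (monotone for `B < Cᵢ < A`) and every `U ⊆ S`: `0 ≤ Ψ_U(f) = Σ_{W ⊆ U} Σ_{X ⊆ S∖W} λ(f W; f X, f(S∖W∖X))`.
`U = ∅` is PROVED (`pivotSum_empty_nonneg`); `U = S` is CP3⁺ at pure patterns (`PurePatternCP3Plus`); `U = S ∖ {e}` is the
asymmetric ordered two-labeling law `Ψ(g; h, g) ≥ 0`.  Exact census (gen 15): exhaustive on `2^4` (all `U`), 6·10⁶
random/adversarial systems on `2^5 … 2^7`, `k ≤ 5`: no failure, minimum `0`.  FALSE for "twisted" (non-monotone, mixed-pattern)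
labelings, so this is a statement about sunflowers of UP-SETS only. [this work] [status: open] -/
@[conjecture] def PivotFamilyNonneg (k : ℕ) : Prop :=
  ∀ (S U : Finset ℕ) (f : Finset ℕ → Lab k), (∀ ⦃X Y : Finset ℕ⦄, X ⊆ Y → f X ≤ f Y) → U ⊆ S → 0 ≤ pivotSum S U f

/-- **CONJECTURE CP3⁺ at pure patterns (typed)** — the member `U = S`: for every sunflower labeling `f` of `2^S`,
`0 ≤ Σ_{ordered tripartitions (W,X,Y) of S} λ(f W; f X, f Y) = 2·#AAB + 2·#ABB − #ACD − #BCD − #CDE`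
(the seat's comb conjecture CP3⁺ of gen 13 on the fibres whose mixed coordinates carry one `1`; its measure shadow is
`SahiDeepCore.StrongCubicPlusNonneg`, which needs ALL fibres). [this work] [status: open] -/
@[conjecture] def PurePatternCP3Plus (k : ℕ) : Prop :=
  ∀ (S : Finset ℕ) (f : Finset ℕ → Lab k), (∀ ⦃X Y : Finset ℕ⦄, X ⊆ Y → f X ≤ f Y) → 0 ≤ pivotSum S S f

/-- **Kernel link: the pivot family contains CP3⁺ at pure patterns** (member `U = S`). [this work] -/
theorem purePatternCP3Plus_of_pivotFamily (hk : PivotFamilyNonneg k) : PurePatternCP3Plus k :=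
  fun S f hf => hk S S f hf subset_rfl

/-- **Kernel link, idle form**: already the members `U = S ⊊ S ∪ {e}` of the family (pivots avoiding ONE coordinate),
applied to idle extensions, give CP3⁺ at pure patterns. [this work] -/
theorem purePatternCP3Plus_of_pivotFamily_idle
    (hk : ∀ (S : Finset ℕ) (e : ℕ) (f : Finset ℕ → Lab k), e ∉ S →
      (∀ ⦃X Y : Finset ℕ⦄, X ⊆ Y → f X ≤ f Y) → 0 ≤ pivotSum (insert e S) S (fun X => f (X.erase e))) :
    PurePatternCP3Plus k := by
  intro S f hf
  obtain ⟨e, he⟩ : ∃ e : ℕ, e ∉ S := Infinite.exists_notMem_finset S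
  have h := hk S e f he hf
  rw [pivotSum_idle S he f] at h
  linarith


/-! ### 5. The first rung: the members `|U| = 1` (PROVED; still a consequence of the antipodal Gladkov inequality) -/

/-- `rainbow` is an indicator, in particular nonnegative. [this work] -/
theorem rainbow_nonneg (a b c : Lab k) : 0 ≤ rainbow a b c := by
  rcases a with _ | i | _ <;> rcases b with _ | j | _ <;> rcases c with _ | l | _ <;> simp only [rainbow] <;>
    first | exact le_rfl | exact ite_nonneg zero_le_one le_rfl

/-- **The four-label exchange inequality behind the rung `|U| = 1`.**  If `x ≤ x'`, `y ≤ y'` and both primed labels lie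
above the petal `Cᵢ`, then `κ(x,y) + [Cᵢ, x, y rainbow] ≤ κ(x, y') + κ(x', y)`: reading one member of an antipodal pair
through an upper section that has passed `Cᵢ` never loses a polar pair, and turns every rainbow-completing pair `(Cⱼ, Cₗ)`
into two harmless `(Cⱼ, A)` readings (finite check). [this work] -/
theorem kappa_exchange_ge_rainbow {i : Fin k} {x x' y y' : Lab k} (hx : x ≤ x') (hy : y ≤ y')
    (hix : petal i ≤ x') (hiy : petal i ≤ y') :
    kappa x y + rainbow (petal i) x y ≤ kappa x y' + kappa x' y := by
  rw [le_def] at hx hy hix hiy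
  rcases x with _ | a | _ <;> rcases x' with _ | a' | _ <;> rcases y with _ | b | _ <;> rcases y' with _ | b' | _ <;>
    simp_all [kappa, rainbow] <;> split_ifs <;> simp_all

/-- `U = {a}`: the empty pivot plus the pivot `{a}`, whose pair lives in the cube `2^{S ∖ {a}}`. [this work] -/
theorem pivotSum_singleton (S : Finset α) (a : α) (f : Finset α → Lab k) :
    pivotSum S {a} f = pivotSum S ∅ f +
      ∑ X ∈ (S.erase a).powerset, lam (f {a}) (f X) (f ((S.erase a) \ X)) := by
  have h1 : ({a} : Finset α).powerset = {∅, {a}} := by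
    ext T; rw [mem_powerset, subset_singleton_iff, mem_insert, mem_singleton]
  rw [pivotSum, h1, sum_pair (by simp), pivotSum_empty, sdiff_empty, Finset.sdiff_singleton_eq_erase a S]

/-- **The rung `|U| = 1` (PROVED).**  For every sunflower labeling `f` of `2^S` and every `a ∈ S`, `0 ≤ Ψ_{{a}}(f)`.
If `f {a}` is polar both pivots `∅`, `{a}` carry Gladkov surpluses.  If `f {a} = Cᵢ`, the pivot `{a}` costs the
`(Cⱼ,Cₗ)`-pairs `R` of the cube `2^{S∖a}` (`j, l ≠ i`), and the empty pivot pays: splitting its antipodal sum along `a`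
(`antipodalSum_insert`) and applying `kappa_exchange_ge_rainbow` termwise (the upper section `f(· ∪ {a}) ≥ Cᵢ`) gives
`C(f,h) + C(h,f) ≥ C(f,f) + R ≥ R`, whence `Ψ_{{a}} ≥ 3R − R ≥ 0`.  (This member is thus implied by Gladkov's inequality on
`2^{S∖a}`; the first member beyond the Gladkov lifts is `|U| = 2`.) [this work] -/
theorem pivotSum_singleton_nonneg (S : Finset α) {a : α} (ha : a ∈ S) (f : Finset α → Lab k)
    (hf : ∀ ⦃X Y : Finset α⦄, X ⊆ Y → f X ≤ f Y) : 0 ≤ pivotSum S {a} f := by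
  rw [pivotSum_singleton S a f]
  have h0 := pivotSum_empty_nonneg S f hf
  set S' := S.erase a with hS'
  rcases polar_eq_zero_or_one (f {a}) with hpa | hpa
  · -- `f {a}` is a petal `Cᵢ`
    obtain ⟨i, hi⟩ : ∃ i, f {a} = petal i := by
      rcases hfa : f {a} with _ | i | _
      · simp [hfa, polar] at hpa
      · exact ⟨i, rfl⟩
      · simp [hfa, polar] at hpa
    have hterm : ∀ X ∈ S'.powerset, lam (f {a}) (f X) (f (S' \ X)) = -rainbow (petal i) (f X) (f (S' \ X)) := by
      intro X _; rw [lam_of_not_polar hpa, hi]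
    rw [sum_congr rfl hterm, sum_neg_distrib]
    -- the empty pivot pays
    rcases polar_eq_zero_or_one (f ∅) with hp0 | hp0
    · -- `f ∅` petal: then `f ∅ = Cᵢ`, every label is `Cᵢ` or `A`, no rainbow at all
      have hR : ∑ X ∈ S'.powerset, rainbow (petal i) (f X) (f (S' \ X)) = 0 := by
        refine sum_eq_zero fun X _ => ?_
        have h01 : f ∅ ≤ f {a} := hf (empty_subset _)
        have hfe : f ∅ = petal i := by
          rw [le_def, hi] at h01
          rcases h01 with h | h | h
          · rw [h] at hp0; simp [polar] at hp0
          · cases h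
          · exact h
        have : petal i ≤ f X := hfe ▸ hf (empty_subset X)
        exact rainbow_eq_zero_of_le this _
      rw [hR]; simpa using h0
    · rw [pivotSum_empty_of_polar S f hp0]
      have haS' : a ∉ S' := Finset.notMem_erase a S
      have hSS : S = insert a S' := (Finset.insert_erase ha).symm
      rw [hSS, antipodalSum_insert haS']
      -- termwise exchange inequality
      have key : antipodalSum S' f f + ∑ X ∈ S'.powerset, rainbow (petal i) (f X) (f (S' \ X)) ≤
          antipodalSum S' f (fun X => f (insert a X)) + antipodalSum S' (fun X => f (insert a X)) f := by
        unfold antipodalSum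
        rw [← sum_add_distrib, ← sum_add_distrib]
        refine sum_le_sum fun X _ => ?_
        have hx : f X ≤ f (insert a X) := hf (subset_insert a X)
        have hy : f (S' \ X) ≤ f (insert a (S' \ X)) := hf (subset_insert a _)
        have hix : petal i ≤ f (insert a X) := hi ▸ hf (by simp)
        have hiy : petal i ≤ f (insert a (S' \ X)) := hi ▸ hf (by simp)
        have := kappa_exchange_ge_rainbow hx hy hix hiy
        linarith
      have hG := antipodalSum_self_nonneg S' f hf
      have hRnn : 0 ≤ ∑ X ∈ S'.powerset, rainbow (petal i) (f X) (f (S' \ X)) :=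
        sum_nonneg fun X _ => rainbow_nonneg _ _ _
      linarith
  · -- `f {a}` polar: the pivot `{a}` carries a Gladkov surplus too
    have hterm : ∀ X ∈ S'.powerset, lam (f {a}) (f X) (f (S' \ X)) = 3 * kappa (f X) (f (S' \ X)) := by
      intro X _; rw [lam_of_polar hpa]
    rw [sum_congr rfl hterm, ← mul_sum]
    have hG := antipodalSum_self_nonneg S' f hf
    unfold antipodalSum at hG
    linarith

/-! ### 6. Ground-set monotonicity: the proved end `U = ∅` and the conjectured end `U = S` ("lower-section domination") -/

/-- **Ground-set monotonicity at `U = ∅` (PROVED).**  Enlarging the cube by a coordinate `e` that the (empty) pivot does not use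
never decreases the member `U = ∅`: `Ψ^{S∪{e}}_∅(F) ≥ Ψ^S_∅(F)`.  For a polar `F ∅` this is the antipodal-Harris rectangle
`C(g,h) + C(h,g) ≥ C(g,g) + C(h,h) ≥ C(g,g)` for the sections `g = F ≤ h = F(· ∪ {e})` (termwise `kappa_submod` of the tree plus
`antipodalSum_self_nonneg` for `h`); for a petal `F ∅` both sides vanish. [this work] -/
theorem pivotSum_empty_mono (S : Finset α) {e : α} (he : e ∉ S) (F : Finset α → Lab k)
    (hF : ∀ ⦃X Y : Finset α⦄, X ⊆ Y → F X ≤ F Y) : pivotSum S ∅ F ≤ pivotSum (insert e S) ∅ F := by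
  rcases polar_eq_zero_or_one (F ∅) with h0 | h0
  · rw [pivotSum_empty_of_not_polar S F hF h0, pivotSum_empty_of_not_polar (insert e S) F hF h0]
  · rw [pivotSum_empty_of_polar S F h0, pivotSum_empty_of_polar (insert e S) F h0, antipodalSum_insert he]
    have hmono := monotone_comp_insert hF e
    -- rectangle: C(F,F) + C(h,h) ≤ C(F,h) + C(h,F)
    have key : antipodalSum S F F + antipodalSum S (fun X => F (insert e X)) (fun X => F (insert e X)) ≤
        antipodalSum S F (fun X => F (insert e X)) + antipodalSum S (fun X => F (insert e X)) F := by
      unfold antipodalSum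
      rw [← sum_add_distrib, ← sum_add_distrib]
      refine sum_le_sum fun X _ => ?_
      have h1 : F X ≤ F (insert e X) := hF (subset_insert e X)
      have h2 : F (S \ X) ≤ F (insert e (S \ X)) := hF (subset_insert e _)
      have := kappa_submod h1 h2
      linarith
    have hh := antipodalSum_self_nonneg S (fun X => F (insert e X)) hmono
    linarith

/-- **CONJECTURE M (lower-section domination; typed).**  For every sunflower labeling `F` of `2^{S ∪ {e}}` (`e ∉ S`):
`Ψ^{S∪{e}}_S(F) ≥ Ψ^S_S(F)` — the members of the family whose pivots avoid `e`, on the big cube, dominate the FULL tripartition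
functional (CP3⁺ form) of the facet `e = 0`; in section form `2·Ψ(g; h, g) ≥ Ψ(g; g, g)`.  It contains CP3⁺ at pure patterns (idle `e`:
`pivotSum_idle`) and hence the member (**) of `PivotFamilyNonneg`; census gen 15: ≈ 9·10⁶ pairs `(F, e)` on `2^4 … 2^7` incl. annealing,
0 failures, minimum exactly `0`, and `min Ψ(g;h,g)/Ψ(g;g,g) = 1/2` exactly in every dimension tested.  The analogous monotonicity for
intermediate pivot sets `∅ ⊊ U ⊊ S` is FALSE, as are the companion `Ψ(h;g,g) + Ψ(g;g,g) ≥ 0` and every termwise version (memo §9).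
[this work] [status: open] -/
@[conjecture] def LowerSectionDomination (k : ℕ) : Prop :=
  ∀ (S : Finset ℕ) (e : ℕ) (F : Finset ℕ → Lab k), e ∉ S → (∀ ⦃X Y : Finset ℕ⦄, X ⊆ Y → F X ≤ F Y) →
    pivotSum S S F ≤ pivotSum (insert e S) S F

/-- **M contains CP3⁺ at pure patterns** (apply it to an idle coordinate: `2Ψ_S ≥ Ψ_S`). [this work] -/
theorem purePatternCP3Plus_of_lowerSectionDomination (hM : LowerSectionDomination k) : PurePatternCP3Plus k := by
  intro S f hf
  obtain ⟨e, he⟩ : ∃ e : ℕ, e ∉ S := Infinite.exists_notMem_finset S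
  have hmono : ∀ ⦃X Y : Finset ℕ⦄, X ⊆ Y → (fun X => f (X.erase e)) X ≤ (fun X => f (X.erase e)) Y :=
    fun X Y hXY => hf (erase_subset_erase e hXY)
  have h := hM S e (fun X => f (X.erase e)) he hmono
  rw [pivotSum_idle S he f] at h
  have hS : pivotSum S S (fun X => f (X.erase e)) = pivotSum S S f := by
    unfold pivotSum
    refine sum_congr rfl fun W hW => sum_congr rfl fun X hX => ?_
    have hWS : W ⊆ S := mem_powerset.mp hW
    have hXS : X ⊆ S \ W := mem_powerset.mp hX
    have h1 : W.erase e = W := erase_eq_of_notMem fun h' => he (hWS h')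
    have h2 : X.erase e = X := erase_eq_of_notMem fun h' => he ((mem_sdiff.mp (hXS h')).1)
    have h3 : ((S \ W) \ X).erase e = (S \ W) \ X :=
      erase_eq_of_notMem fun h' => he ((mem_sdiff.mp ((mem_sdiff.mp h').1)).1)
    simp only [h1, h2, h3]
  rw [hS] at h
  linarith

/-- **M gives the member `U = S ⊊ S ∪ {e}` of the pivot family ((**))**: `0 ≤ Ψ^S_S(F) ≤ Ψ^{S∪{e}}_S(F)`, the first inequality being
CP3⁺ for the facet, itself a consequence of M. [this work] -/
theorem pivotSum_avoiding_nonneg_of_lowerSectionDomination (hM : LowerSectionDomination k) (S : Finset ℕ) {e : ℕ}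
    (he : e ∉ S) (F : Finset ℕ → Lab k) (hF : ∀ ⦃X Y : Finset ℕ⦄, X ⊆ Y → F X ≤ F Y) :
    0 ≤ pivotSum (insert e S) S F :=
  le_trans (purePatternCP3Plus_of_lowerSectionDomination hM S F hF) (hM S e F he hF)

end SahiPivotFamily

end Summit.CriticalPhenomena.PercolationContinuityZ3.Theorems
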